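import Mathlib
import Summits.ValiantsHypothesis.ValiantsHypothesis.Theses.ValuativeGCT
import Literature.Computability.AlgebraicComplexity.MultiplicityObstructionsProofs

/-!
# Drefute (stmt-ValiantsHypothesis-12624, line `skew-restriction-rank`): no flip where `Det_m` is equation-free

Negative bookkeeping lemma behind `DrefuteStubJetCensusFlip.md`: given the route's own `ValuativeBound`
(stmt-12625) and BLMW's plethysm bound (tree, discharged: `orbitMultiplicity_le_plethysmCoeff_holds`), a
`ValuativeFlip` witness `(U, r, δ, λ)` at `(n, m)` forces `K_m(λ*) < pleth(λ; δ, m)`, i.e. the orbit closure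
`Det_m` must carry equations of type `λ` in degree `δ`.  Contrapositive form: if `K_m(λ*) = pleth(λ*)`
("`Det_m` has no equation of type λ in degree δ" — known for all λ when δ ≤ 4 ≤ m by Hadamard–Howe /
Müller–Neunhöffer / McKay, δ = 5 ≤ m - 1 by Cheung–Ikenmeyer–Mkrtchyan 2017 Thm 5(a), and δ = 5 = m by the
computation of kit job j008026), then the padded-permanent multiplicity is at most `dim T_U(λ)`: no flip.
Sorry-free; axioms standard.  Not a Theorems landing (helper; evidence for the lead / cdisprove).
-/

set_option linter.dupNamespace false

namespace Summit.ValiantsHypothesis.ValiantsHypothesis.Cruxes.ValuativeFlip.Drefute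

open Literature.NumberTheory.DiophantineGeometry Literature.Computability.AlgebraicComplexity
open Summit.ValiantsHypothesis.ValiantsHypothesis.Theses.ValuativeGCT

/-- Equation-freeness of `Det_m` at `χ` plus BLMW 4.4.1: the padded permanent's multiplicity at `χ` is at most
the determinant's. -/
theorem orbitMultiplicity_paddedPer_le_det_of_eqFree {n m : ℕ} [NeZero m] (hnm : n ≤ m)
    (χ : Weight (MatIdx m))
    (hfree : orbitMultiplicity ℂ (detFormLex ℂ m) m χ = plethysmCoeff ℂ (MatIdx m) m χ) :
    orbitMultiplicity ℂ (paddedPerFormLex ℂ n m) m χ ≤ orbitMultiplicity ℂ (detFormLex ℂ m) m χ := by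
  rw [hfree]
  exact orbitMultiplicity_le_plethysmCoeff_holds _ (NeZero.ne m) (paddedPerFormLex_isHomogeneous (k := ℂ) hnm) χ

/-- **No valuative flip where `Det_m` is equation-free.** Under `ValuativeBound`, for every admissible centre
`(U, r)`, degree `δ` and shape `λ` with `K_m(λ*) = pleth(λ*)`, the crux's truncation `T_U(λ)` (verbatim) has
`finrank ≥ mult_pp(λ*)`; in particular the `ValuativeFlip` inequality `finrank T < mult_pp` fails at these data. -/
theorem no_flip_of_eqFree (hVB : ValuativeBound) {n : ℕ} (m : ℕ) [NeZero m] (hnm : n ≤ m)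
    (U : Submodule ℂ (MatIdx m → ℂ)) (r : ℕ)
    (hU : ∀ u ∈ U, (Matrix.of fun a b : Fin m => u (toLex (a, b))).rank ≤ r)
    (δ : ℕ) (lam : Nat.Partition (m * δ)) (hcard : lam.parts.card ≤ m * m)
    (hfree : orbitMultiplicity ℂ (detFormLex ℂ m) m (Weight.dualOfPartition (m * m) lam).toMatIdx =
      plethysmCoeff ℂ (MatIdx m) m (Weight.dualOfPartition (m * m) lam).toMatIdx) :
    let χ : Literature.NumberTheory.DiophantineGeometry.Weight (Literature.NumberTheory.DiophantineGeometry.MatIdx m) := (Literature.NumberTheory.DiophantineGeometry.Weight.dualOfPartition (m * m) lam).toMatIdx; let T : Submodule ℂ (MvPolynomial (Literature.NumberTheory.DiophantineGeometry.MatIdx m × Literature.NumberTheory.DiophantineGeometry.MatIdx m) ℂ) := MvPolynomial.homogeneousSubmodule (Literature.NumberTheory.DiophantineGeometry.MatIdx m × Literature.NumberTheory.DiophantineGeometry.MatIdx m) ℂ (m * δ) ⊓ ((MvPolynomial.vanishingIdeal ℂ {p : Literature.NumberTheory.DiophantineGeometry.MatIdx m × Literature.NumberTheory.DiophantineGeometry.MatIdx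 m → ℂ | ∀ j : Literature.NumberTheory.DiophantineGeometry.MatIdx m, (fun i => p (j, i)) ∈ U}) ^ (δ * (m - r))).restrictScalars ℂ ⊓ (⨅ (M : Matrix (Literature.NumberTheory.DiophantineGeometry.MatIdx m) (Literature.NumberTheory.DiophantineGeometry.MatIdx m) ℂ) (_ : Literature.Computability.AlgebraicComplexity.linSubst (Literature.NumberTheory.DiophantineGeometry.MatIdx m) ℂ M (Literature.NumberTheory.DiophantineGeometry.detFormLex ℂ m) = Literature.NumberTheory.DiophantineGeometry.detFormLex ℂ m), LinearMap.ker ((MvPolynomial.aeval (R := ℂ) fun p : Literature.NumberTheory.DiophantineGeometry.MatIdx m × Literature.NumberTheory.DiophantineGeometry.MatIdx m => ∑ l : Literature.NumberTheory.DiophantineGeometry.MatIdx m, M l p.2 • MvPolynomial.X (p.1, l)).toLinearMap - LinearMap.id (R := ℂ) (M := MvPolynomial (Literature.NumberTheory.DiophantineGeometry.MatIdx m × Literature.NumberTheory.DiophantineGeometry.MatIdx m) ℂ))) ⊓ (⨅ (g : Matrix.GeneralLinearGroup (Literature.NumberTheory.DiophantineGeometry.MatIdx m) ℂ) (_ : Literature.NumberTheory.DiophantineGeometry.IsUpperTriangular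 g), LinearMap.ker ((MvPolynomial.aeval (R := ℂ) fun p : Literature.NumberTheory.DiophantineGeometry.MatIdx m × Literature.NumberTheory.DiophantineGeometry.MatIdx m => ∑ l : Literature.NumberTheory.DiophantineGeometry.MatIdx m, ((g⁻¹ : Matrix.GeneralLinearGroup (Literature.NumberTheory.DiophantineGeometry.MatIdx m) ℂ) : Matrix (Literature.NumberTheory.DiophantineGeometry.MatIdx m) (Literature.NumberTheory.DiophantineGeometry.MatIdx m) ℂ) p.1 l • MvPolynomial.X (l, p.2)).toLinearMap - Literature.NumberTheory.DiophantineGeometry.weightChar χ g • LinearMap.id (R := ℂ) (M := MvPolynomial (Literature.NumberTheory.DiophantineGeometry.MatIdx m × Literature.NumberTheory.DiophantineGeometry.MatIdx m) ℂ))); Literature.NumberTheory.DiophantineGeometry.orbitMultiplicity ℂ (Literature.NumberTheory.DiophantineGeometry.paddedPerFormLex ℂ n m) m χ ≤ Module.finrank ℂ ↥T := by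
  intro χ T
  have hB : orbitMultiplicity ℂ (detFormLex ℂ m) m χ ≤ Module.finrank ℂ ↥T := hVB m U r hU δ lam hcard
  exact (orbitMultiplicity_paddedPer_le_det_of_eqFree hnm χ hfree).trans hB

end Summit.ValiantsHypothesis.ValiantsHypothesis.Cruxes.ValuativeFlip.Drefute
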